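import Mathlib
import HarnessLib

/-!
# LaunchIntervalLaw — the `n_between` lever has an optimum: under the certified geometric envelope of
# the restart chain's variance inflation, `C(m) = 1 + 2α·q^m/(1 − q^m)`, the cost per effectively
# independent evolution `(A + m)·C(m)` is minimised at a launch interval `m⋆ ≈ τ·log(1 + 2αA/τ)`
# (`τ = 1/(−log q)`), where the penalty of correlated launches is ADDITIVE — about
# `τ·(1 + log(2αA/τ))` sweeps per evolution — and the inflation factor is at most `1 + τ/A`

HONEST FRAMING: exact (Metropolis-corrected) sampling algorithms for lattice gauge theory;
figures of merit are autocorrelation/cost numbers at stated couplings and volumes; no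
continuum-physics claim.

Venture `LatticeQCDFlow` (cell pub-lqcd), topic `Scaling`; FANOUT row 19 (`su2-snf`, GEN-9: lever
`protocol.n_between` of the family-C protocol — non-equilibrium evolutions launched every
`n_between = m` sweeps of an equilibrium prior chain).  OUR WORK, elementary real analysis; nothing
is cited as a fact.  It is the `n_between` companion of `Scaling/NonEquilibriumOverhead` (the
`n_step` optimum with a fixed per-evolution overhead) and `Scaling/SweepAllocationLaw` (sweeps per
protocol step), and it optimises the CERTIFIED quantities of the `Exactness/` sample-size files:

* along the restart chain the number of evolutions `N` that suffices for the Jarzynski / reweighting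
  estimators is the independent-evolutions threshold times a VARIANCE-INFLATION factor `C`
  (`Exactness/NCMCGeneralSpaceSampleSizeVarianceInflation`, `…RestartChainSampleSize`: `N_eff = N/C`);
* a one-sweep Doeblin / spectral envelope `q = 1 − ε` of the prior sampler gives, after `m` sweeps,
  the residual `q^m` (`Exactness/NCMCGeneralSpaceLaunchInterval.doeblin_nHit_geometric`:
  `ε_m = 1 − (1 − ε)^m`), hence `C(m) ≤ 2/(1 − q^m) − 1 = (1 + q^m)/(1 − q^m)`;
* row 8's dilution law (`Scoring/RestartChainAutocorrelation`: the lag-`t ≥ 1` autocovariances of a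
  record observable `G` along the restart chain are those of its conditional mean given the start,
  `h = E[G | start]`, so only the fraction `α = Var h/Var G ∈ [0, 1]` of the variance is inflated)
  refines this to **`C(m) = 1 + 2α·q^m/(1 − q^m)`** (`α = 1`: the Doeblin form; `α = 0`: no
  inflation — the work is protocol noise, uncorrelated at any launch interval).

With `A ≥ 0` the cost of one evolution (protocol steps + measurements) in units of prior sweeps, the
cost per EFFECTIVELY independent evolution is `g(m) = (A + m)·C(m)` (times the `m`-independent
`1/ESS` of the protocol, which factors out of the `m`-optimisation).  Everything below is about this
envelope; `λ = −log q ≥ 1 − q = ε`, `τ := 1/λ ≤ 1/ε`.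

## Content (all `[ours]`; `0 < q < 1`, `0 ≤ α`, `A ≥ 0`, `m ∈ ℕ`)

* §1 the envelope: `launchInflation_alpha_one` (`α = 1`: `= 2/(1 − q^m) − 1`), `one_le_launchInflation`,
  `launchInflation_anti` (non-increasing in `m`), `pow_eq_exp_neg_mul_log` (`q^m = e^{−λm}`),
  `one_sub_le_neg_log` (`ε ≤ λ`);
* §2 THE FLOOR (`launchCost_ge_floor`): for EVERY `m ≥ 1`,
  **`A + τ·(1 + log(2αA/τ)) ≤ (A + m)·C(m)`** (`x + e^{−x} ≥ 1` at `x = λm − log(2αλA)`; informative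
  when `2αA ≥ τ`, and `A + m ≤ g(m)` always, `launchCost_ge_linear`);
* §3 THE CEILING (`launchCost_le_of_pow_le`, `launchInflation_le_of_pow_le`): every `m` with
  `q^m·(1 + 2αA/τ) ≤ 1`, i.e. `m ≥ τ·log(1 + 2αA/τ)`, has **`C(m) ≤ 1 + τ/A`** and
  **`g(m) ≤ (A + m)·(1 + τ/A)`**; the integer `m₀ = ⌈τ·log(1 + 2αA/τ)⌉` qualifies
  (`launchCost_le_ceiling`: `g(m₀) ≤ (A + τ·log(1 + 2αA/τ) + 1)·(1 + τ/A)`);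
* §4 readings: `launchCost_alpha_zero` (`α = 0`: `g(m) = A + m`, launch as often as possible);
  `launchCost_two_sided` (floor and ceiling together: the optimal cost is `A` plus an ADDITIVE
  `Θ(τ·log(2αA/τ))` sweeps, never a multiplicative factor on `A`).

Reading for family C (value-free): `A` = (`n_step` protocol steps × cost of a defect-local step +
measurement sweeps)/(cost of one full prior sweep); `q` per sweep and `α` are properties of the prior
sampler and of the protocol (`α·q^m` bounds the lag-1 autocorrelation of successive weights, row 8);
the rule `n_between ≈ τ·log(1 + 2αA/τ)` and the guarantee `C ≤ 1 + τ/A` replace "set `n_between` so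
that successive weights look uncorrelated".  NOT CLAIMED: values of `q`, `α`, `τ` for any concrete
sampler; that the envelope `C(m)` is attained (it is an upper bound — the floor of §2 is a floor of
the ENVELOPE, not of the true cost); anything numerical.
-/

namespace Summit.Ventures.LatticeQCDFlow.Scaling

open Real

/-! ## §1 The certified inflation envelope `C(m) = 1 + 2α q^m/(1 − q^m)` -/

/-- `q^m < 1` for `0 ≤ q < 1`, `m ≥ 1`. [ours] -/
theorem pow_lt_one_of_launch {q : ℝ} (hq0 : 0 ≤ q) (hq1 : q < 1) {m : ℕ} (hm : 1 ≤ m) :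
    q ^ m < 1 :=
  pow_lt_one₀ hq0 hq1 (by omega)

/-- **`α = 1` is the Doeblin form**: `1 + 2·q^m/(1 − q^m) = 2/(1 − q^m) − 1` (`m ≥ 1`), the factor of
`Exactness/NCMCGeneralSpaceRestartChainSampleSize` with `ε_m = 1 − q^m`. [ours] -/
theorem launchInflation_alpha_one {q : ℝ} (hq0 : 0 ≤ q) (hq1 : q < 1) {m : ℕ} (hm : 1 ≤ m) :
    1 + 2 * 1 * q ^ m / (1 - q ^ m) = 2 / (1 - q ^ m) - 1 := by
  have h : 1 - q ^ m ≠ 0 := (sub_pos.2 (pow_lt_one_of_launch hq0 hq1 hm)).ne'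
  field_simp
  ring

/-- The same as `(1 + q^m)/(1 − q^m)` — the AR(1) `2τ_int` factor of `Scaling/SweepAllocationLaw`. [ours] -/
theorem launchInflation_alpha_one' {q : ℝ} (hq0 : 0 ≤ q) (hq1 : q < 1) {m : ℕ} (hm : 1 ≤ m) :
    1 + 2 * 1 * q ^ m / (1 - q ^ m) = (1 + q ^ m) / (1 - q ^ m) := by
  have h : 1 - q ^ m ≠ 0 := (sub_pos.2 (pow_lt_one_of_launch hq0 hq1 hm)).ne'
  field_simp
  ring

/-- `1 ≤ C(m)` (`α ≥ 0`, `m ≥ 1`). [ours] -/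
theorem one_le_launchInflation {q α : ℝ} (hq0 : 0 ≤ q) (hq1 : q < 1) (hα : 0 ≤ α) {m : ℕ}
    (hm : 1 ≤ m) : 1 ≤ 1 + 2 * α * q ^ m / (1 - q ^ m) := by
  have h : 0 < 1 - q ^ m := sub_pos.2 (pow_lt_one_of_launch hq0 hq1 hm)
  have : 0 ≤ 2 * α * q ^ m / (1 - q ^ m) := div_nonneg (by positivity) h.le
  linarith

/-- `C(m)` is non-increasing in the launch interval (`α ≥ 0`): on `m ≥ 1`,
`m ≤ m' → C(m') ≤ C(m)`. [ours] -/
theorem launchInflation_anti {q α : ℝ} (hq0 : 0 ≤ q) (hq1 : q < 1) (hα : 0 ≤ α) {m m' : ℕ}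
    (hm : 1 ≤ m) (hmm' : m ≤ m') :
    1 + 2 * α * q ^ m' / (1 - q ^ m') ≤ 1 + 2 * α * q ^ m / (1 - q ^ m) := by
  have hqm : q ^ m' ≤ q ^ m := pow_le_pow_of_le_one hq0 hq1.le hmm'
  have h1 : 0 < 1 - q ^ m := sub_pos.2 (pow_lt_one_of_launch hq0 hq1 hm)
  have h1' : 0 < 1 - q ^ m' := sub_pos.2 (pow_lt_one_of_launch hq0 hq1 (hm.trans hmm'))
  have hfrac : q ^ m' / (1 - q ^ m') ≤ q ^ m / (1 - q ^ m) := by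
    rw [div_le_div_iff₀ h1' h1]
    nlinarith [pow_nonneg hq0 m, pow_nonneg hq0 m']
  have := mul_le_mul_of_nonneg_left hfrac (by positivity : (0:ℝ) ≤ 2 * α)
  calc 1 + 2 * α * q ^ m' / (1 - q ^ m') = 1 + 2 * α * (q ^ m' / (1 - q ^ m')) := by ring
    _ ≤ 1 + 2 * α * (q ^ m / (1 - q ^ m)) := by linarith
    _ = 1 + 2 * α * q ^ m / (1 - q ^ m) := by ring

/-- `q^m = e^{−λ m}` with `λ = −log q` (`q > 0`). [ours] -/
theorem pow_eq_exp_neg_mul_log {q : ℝ} (hq : 0 < q) (m : ℕ) :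
    q ^ m = Real.exp (-(-Real.log q) * m) := by
  rw [neg_neg, mul_comm, Real.exp_nat_mul, Real.exp_log hq]

/-- `ε = 1 − q ≤ λ = −log q` (`q > 0`): the relaxation time `τ = 1/λ` is at most `1/ε`. [ours] -/
theorem one_sub_le_neg_log {q : ℝ} (hq : 0 < q) : 1 - q ≤ -Real.log q := by
  have := Real.log_le_sub_one_of_pos hq
  linarith

/-- `0 < λ = −log q` for `0 < q < 1`. [ours] -/
theorem neg_log_pos_of_lt_one {q : ℝ} (hq0 : 0 < q) (hq1 : q < 1) : 0 < -Real.log q := by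
  have := Real.log_neg hq0 hq1
  linarith

/-! ## §2 The floor: `A + τ(1 + log(2αA/τ)) ≤ (A + m)·C(m)` for every `m` -/

/-- `1 ≤ x + e^{−x}` for every real `x`. [ours] -/
theorem one_le_add_exp_neg (x : ℝ) : 1 ≤ x + Real.exp (-x) := by
  have := Real.add_one_le_exp (-x)
  linarith

/-- **The one-dimensional floor**: for `λ > 0`, `K > 0` and every real `m`,
`(1 + log(λK))/λ ≤ m + K·e^{−λm}` (equality at `e^{λm} = λK`). [ours] -/
theorem launch_floor {lam K : ℝ} (hlam : 0 < lam) (hK : 0 < K) (m : ℝ) :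
    (1 + Real.log (lam * K)) / lam ≤ m + K * Real.exp (-lam * m) := by
  have hx := one_le_add_exp_neg (lam * m - Real.log (lam * K))
  have hexp : Real.exp (-(lam * m - Real.log (lam * K))) = lam * (K * Real.exp (-lam * m)) := by
    rw [neg_sub, Real.exp_sub, Real.exp_log (mul_pos hlam hK), neg_mul, Real.exp_neg]
    field_simp
  rw [hexp] at hx
  rw [div_le_iff₀ hlam]
  nlinarith

/-- `A + m ≤ (A + m)·C(m)` (`α ≥ 0`, `m ≥ 1`): correlated launches never help. [ours] -/
theorem launchCost_ge_linear {q α A : ℝ} (hq0 : 0 ≤ q) (hq1 : q < 1) (hα : 0 ≤ α) (hA : 0 ≤ A)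
    {m : ℕ} (hm : 1 ≤ m) : A + m ≤ (A + m) * (1 + 2 * α * q ^ m / (1 - q ^ m)) := by
  have h1 := one_le_launchInflation hq0 hq1 hα hm
  have hAm : 0 ≤ A + m := by positivity
  nlinarith

/-- `A + m + 2αA·q^m ≤ (A + m)·C(m)` (`m ≥ 1`). [ours] -/
theorem launchCost_ge_add_pow {q α A : ℝ} (hq0 : 0 ≤ q) (hq1 : q < 1) (hα : 0 ≤ α) (hA : 0 ≤ A)
    {m : ℕ} (hm : 1 ≤ m) :
    A + m + 2 * α * A * q ^ m ≤ (A + m) * (1 + 2 * α * q ^ m / (1 - q ^ m)) := by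
  have hlt := pow_lt_one_of_launch hq0 hq1 hm
  have h1 : 0 < 1 - q ^ m := sub_pos.2 hlt
  have hqm : 0 ≤ q ^ m := pow_nonneg hq0 m
  -- `q^m ≤ q^m/(1 − q^m)`
  have hfrac : q ^ m ≤ q ^ m / (1 - q ^ m) := by
    rw [le_div_iff₀ h1]; nlinarith
  have h2 : 2 * α * A * q ^ m ≤ (A + m) * (2 * α * q ^ m / (1 - q ^ m)) := by
    have hm0 : (0:ℝ) ≤ m := Nat.cast_nonneg m
    calc 2 * α * A * q ^ m ≤ 2 * α * A * (q ^ m / (1 - q ^ m)) :=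
          mul_le_mul_of_nonneg_left hfrac (by positivity)
      _ ≤ 2 * α * (A + m) * (q ^ m / (1 - q ^ m)) := by
          have : 0 ≤ q ^ m / (1 - q ^ m) := div_nonneg hqm h1.le
          exact mul_le_mul_of_nonneg_right (by nlinarith) this
      _ = (A + m) * (2 * α * q ^ m / (1 - q ^ m)) := by ring
  nlinarith

/-- **THE FLOOR OF THE ENVELOPE.**  `0 < q < 1`, `λ = −log q`, `α > 0`, `A > 0`: for EVERY launch
interval `m ≥ 1`, `A + (1 + log(2αA·λ))/λ ≤ (A + m)·(1 + 2α q^m/(1 − q^m))` — the certified cost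
per effectively independent evolution exceeds the evolution's own cost by at least
`τ·(1 + log(2αA/τ))` sweeps, `τ = 1/λ`. [ours] -/
theorem launchCost_ge_floor {q α A : ℝ} (hq0 : 0 < q) (hq1 : q < 1) (hα : 0 < α) (hA : 0 < A)
    {m : ℕ} (hm : 1 ≤ m) :
    A + (1 + Real.log (-Real.log q * (2 * α * A))) / (-Real.log q)
      ≤ (A + m) * (1 + 2 * α * q ^ m / (1 - q ^ m)) := by
  have hlam := neg_log_pos_of_lt_one hq0 hq1
  have hfl := launch_floor hlam (by positivity : 0 < 2 * α * A) (m : ℝ)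
  have hpow : (2 * α * A) * Real.exp (-(-Real.log q) * m) = 2 * α * A * q ^ m := by
    rw [← pow_eq_exp_neg_mul_log hq0 m]
  rw [hpow] at hfl
  have h2 := launchCost_ge_add_pow hq0.le hq1 hα.le hA.le hm
  linarith

/-! ## §3 The ceiling: `m ≥ τ·log(1 + 2αA/τ)` gives `C(m) ≤ 1 + τ/A` -/

/-- **Inflation at a long enough interval**: if `q^m·(1 + 2αλA) ≤ 1` (`λ = −log q`, `A > 0`), then
`C(m) = 1 + 2α q^m/(1 − q^m) ≤ 1 + 1/(λA)`. [ours] -/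
theorem launchInflation_le_of_pow_le {q α A : ℝ} (hq0 : 0 < q) (hq1 : q < 1)
    (hA : 0 < A) {m : ℕ} (hm : 1 ≤ m) (hpow : q ^ m * (1 + 2 * α * (-Real.log q) * A) ≤ 1) :
    1 + 2 * α * q ^ m / (1 - q ^ m) ≤ 1 + 1 / (-Real.log q * A) := by
  have hlam := neg_log_pos_of_lt_one hq0 hq1
  have h1 : 0 < 1 - q ^ m := sub_pos.2 (pow_lt_one_of_launch hq0.le hq1 hm)
  have hlA : 0 < -Real.log q * A := mul_pos hlam hA
  have key : 2 * α * q ^ m / (1 - q ^ m) ≤ 1 / (-Real.log q * A) := by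
    rw [div_le_div_iff₀ h1 hlA]
    nlinarith
  linarith

/-- **Cost at a long enough interval**: under the same hypothesis,
`(A + m)·C(m) ≤ (A + m)·(1 + 1/(λA))`. [ours] -/
theorem launchCost_le_of_pow_le {q α A : ℝ} (hq0 : 0 < q) (hq1 : q < 1)
    (hA : 0 < A) {m : ℕ} (hm : 1 ≤ m) (hpow : q ^ m * (1 + 2 * α * (-Real.log q) * A) ≤ 1) :
    (A + m) * (1 + 2 * α * q ^ m / (1 - q ^ m)) ≤ (A + m) * (1 + 1 / (-Real.log q * A)) :=
  mul_le_mul_of_nonneg_left (launchInflation_le_of_pow_le hq0 hq1 hA hm hpow) (by positivity)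

/-- The integer `m₀ = ⌈log(1 + 2αλA)/λ⌉` satisfies `q^{m₀}·(1 + 2αλA) ≤ 1`. [ours] -/
theorem pow_ceil_mul_le_one {q α A : ℝ} (hq0 : 0 < q) (hq1 : q < 1) (hα : 0 ≤ α) (hA : 0 ≤ A) :
    q ^ ⌈Real.log (1 + 2 * α * (-Real.log q) * A) / (-Real.log q)⌉₊
        * (1 + 2 * α * (-Real.log q) * A) ≤ 1 := by
  have hlam := neg_log_pos_of_lt_one hq0 hq1
  set D := 1 + 2 * α * (-Real.log q) * A with hD
  have hDpos : 0 < D := by rw [hD]; nlinarith [mul_nonneg (mul_nonneg hα hlam.le) hA]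
  set m₀ := ⌈Real.log D / (-Real.log q)⌉₊ with hm₀
  have hceil : Real.log D / (-Real.log q) ≤ (m₀ : ℝ) := Nat.le_ceil _
  have hexp : q ^ m₀ ≤ Real.exp (-Real.log D) := by
    rw [pow_eq_exp_neg_mul_log hq0 m₀, Real.exp_le_exp]
    have : Real.log D ≤ -Real.log q * m₀ := by
      rw [div_le_iff₀ hlam] at hceil; linarith
    linarith
  rw [Real.exp_neg, Real.exp_log hDpos] at hexp
  calc q ^ m₀ * D ≤ D⁻¹ * D := mul_le_mul_of_nonneg_right hexp hDpos.le
    _ = 1 := inv_mul_cancel₀ hDpos.ne'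

/-- … and `m₀ ≥ 1` as soon as `αA > 0`. [ours] -/
theorem one_le_ceil_launch {q α A : ℝ} (hq0 : 0 < q) (hq1 : q < 1) (hα : 0 < α) (hA : 0 < A) :
    1 ≤ ⌈Real.log (1 + 2 * α * (-Real.log q) * A) / (-Real.log q)⌉₊ := by
  have hlam := neg_log_pos_of_lt_one hq0 hq1
  have hpos : 0 < Real.log (1 + 2 * α * (-Real.log q) * A) / (-Real.log q) :=
    div_pos (Real.log_pos (by nlinarith [mul_pos (mul_pos hα hlam) hA])) hlam
  exact Nat.one_le_iff_ne_zero.2 (Nat.ceil_pos.2 hpos).ne'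

/-- **THE CEILING OF THE ENVELOPE AT `m₀ = ⌈τ·log(1 + 2αA/τ)⌉`** (`α > 0`, `A > 0`):
`(A + m₀)·C(m₀) ≤ (A + log(1 + 2αλA)/λ + 1)·(1 + 1/(λA))`. [ours] -/
theorem launchCost_le_ceiling {q α A : ℝ} (hq0 : 0 < q) (hq1 : q < 1) (hα : 0 < α) (hA : 0 < A) :
    (A + (⌈Real.log (1 + 2 * α * (-Real.log q) * A) / (-Real.log q)⌉₊ : ℕ))
        * (1 + 2 * α * q ^ ⌈Real.log (1 + 2 * α * (-Real.log q) * A) / (-Real.log q)⌉₊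
            / (1 - q ^ ⌈Real.log (1 + 2 * α * (-Real.log q) * A) / (-Real.log q)⌉₊))
      ≤ (A + Real.log (1 + 2 * α * (-Real.log q) * A) / (-Real.log q) + 1)
          * (1 + 1 / (-Real.log q * A)) := by
  have hlam := neg_log_pos_of_lt_one hq0 hq1
  set m₀ := ⌈Real.log (1 + 2 * α * (-Real.log q) * A) / (-Real.log q)⌉₊ with hm₀
  have hm1 : 1 ≤ m₀ := one_le_ceil_launch hq0 hq1 hα hA
  have hpow := pow_ceil_mul_le_one hq0 hq1 hα.le hA.le
  have h1 := launchCost_le_of_pow_le hq0 hq1 hA hm1 hpow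
  have hnonneg : 0 ≤ Real.log (1 + 2 * α * (-Real.log q) * A) / (-Real.log q) :=
    div_nonneg (Real.log_nonneg (by nlinarith [mul_pos (mul_pos hα hlam) hA])) hlam.le
  have hceil : (m₀ : ℝ) ≤ Real.log (1 + 2 * α * (-Real.log q) * A) / (-Real.log q) + 1 := by
    have := Nat.ceil_lt_add_one hnonneg
    rw [← hm₀] at this
    exact this.le
  have hfac : 0 ≤ 1 + 1 / (-Real.log q * A) := by positivity
  calc (A + (m₀ : ℝ)) * (1 + 2 * α * q ^ m₀ / (1 - q ^ m₀))
      ≤ (A + m₀) * (1 + 1 / (-Real.log q * A)) := h1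
    _ ≤ (A + Real.log (1 + 2 * α * (-Real.log q) * A) / (-Real.log q) + 1)
          * (1 + 1 / (-Real.log q * A)) := by
        apply mul_le_mul_of_nonneg_right _ hfac
        linarith

/-! ## §4 Readings -/

/-- **`α = 0` (the work is protocol noise): `g(m) = A + m`** — no inflation at any interval, so the
shortest launch interval is the cheapest. [ours] -/
theorem launchCost_alpha_zero (q A : ℝ) (m : ℕ) :
    (A + m) * (1 + 2 * 0 * q ^ m / (1 - q ^ m)) = A + m := by ring

/-- For `α = 0` the cost is strictly increasing in `m`. [ours] -/
theorem launchCost_alpha_zero_strictMono (q A : ℝ) :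
    StrictMono (fun m : ℕ => (A + m) * (1 + 2 * 0 * q ^ m / (1 - q ^ m))) := by
  intro m m' h
  simp only [launchCost_alpha_zero]
  have : (m : ℝ) < m' := by exact_mod_cast h
  linarith

/-- **TWO-SIDED LAW** (`α > 0`, `A > 0`, `λ = −log q`): there is a launch interval `m₀ ≥ 1` with
`m₀ ≤ log(1 + 2αλA)/λ + 1` whose certified cost is at most `(A + log(1 + 2αλA)/λ + 1)(1 + 1/(λA))`,
while EVERY `m ≥ 1` costs at least `A + (1 + log(2αλA))/λ`: the price of correlated launches at the
optimum is an additive `Θ(τ log(2αA/τ))` sweeps per evolution (`τ = 1/λ`), not a factor. [ours] -/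
theorem launchCost_two_sided {q α A : ℝ} (hq0 : 0 < q) (hq1 : q < 1) (hα : 0 < α) (hA : 0 < A) :
    ∃ m₀ : ℕ, 1 ≤ m₀ ∧ (m₀ : ℝ) ≤ Real.log (1 + 2 * α * (-Real.log q) * A) / (-Real.log q) + 1 ∧
      (A + m₀) * (1 + 2 * α * q ^ m₀ / (1 - q ^ m₀))
        ≤ (A + Real.log (1 + 2 * α * (-Real.log q) * A) / (-Real.log q) + 1)
            * (1 + 1 / (-Real.log q * A)) ∧
      ∀ m : ℕ, 1 ≤ m →
        A + (1 + Real.log (-Real.log q * (2 * α * A))) / (-Real.log q)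
          ≤ (A + m) * (1 + 2 * α * q ^ m / (1 - q ^ m)) := by
  have hlam := neg_log_pos_of_lt_one hq0 hq1
  refine ⟨⌈Real.log (1 + 2 * α * (-Real.log q) * A) / (-Real.log q)⌉₊,
    one_le_ceil_launch hq0 hq1 hα hA, ?_, launchCost_le_ceiling hq0 hq1 hα hA,
    fun m hm => launchCost_ge_floor hq0 hq1 hα hA hm⟩
  have hnonneg : 0 ≤ Real.log (1 + 2 * α * (-Real.log q) * A) / (-Real.log q) :=
    div_nonneg (Real.log_nonneg (by nlinarith [mul_pos (mul_pos hα hlam) hA])) hlam.le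
  exact (Nat.ceil_lt_add_one hnonneg).le

/-- **The inflation factor at the optimum window is below `1 + 1/(εA)`** (Doeblin form, `ε = 1 − q`):
every `m ≥ 1` with `q^m(1 + 2αλA) ≤ 1` has `C(m) ≤ 1 + 1/((1 − q)·A)`. [ours] -/
theorem launchInflation_le_doeblin {q α A : ℝ} (hq0 : 0 < q) (hq1 : q < 1)
    (hA : 0 < A) {m : ℕ} (hm : 1 ≤ m) (hpow : q ^ m * (1 + 2 * α * (-Real.log q) * A) ≤ 1) :
    1 + 2 * α * q ^ m / (1 - q ^ m) ≤ 1 + 1 / ((1 - q) * A) := by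
  have h1 := launchInflation_le_of_pow_le hq0 hq1 hA hm hpow
  have hε : 0 < 1 - q := by linarith
  have hle : 1 / (-Real.log q * A) ≤ 1 / ((1 - q) * A) := by
    apply one_div_le_one_div_of_le (mul_pos hε hA)
    exact mul_le_mul_of_nonneg_right (one_sub_le_neg_log hq0) hA.le
  linarith

end Summit.Ventures.LatticeQCDFlow.Scaling
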